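import Literature.NumberTheory.EllipticCurves.WeierstrassAutTorsionRigidityProofs
import Mathlib.AlgebraicGeometry.EllipticCurve.IsomOfJ
import Mathlib.AlgebraicGeometry.EllipticCurve.ModelsWithJ
import Mathlib.FieldTheory.Galois.Infinite
import Mathlib.FieldTheory.KrullTopology
import HarnessLib

/-!
# [IUTchIV] Proposition 1.8 (ii), (iii) in real form: the field of moduli `k(j)`, descent to it,
# and the triviality of `Aut_K(E) = {±1}` on the `2`-torsion

`Proofs` file (theorems only; no definitions, no named facts, no instances) in topic
`NumberTheory/EllipticCurves`, companion of `TorsionRationalDescentProofs` /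
`WeierstrassAutTorsionRigidityProofs` (abc-iut-L5-t12: Prop. 1.8 (iv) and (i) in real form) over the
tree's `VariableChangePoints` (`pointEquiv`), `VariableChangePointsMap` (`congrEquiv`) and
`WeierstrassAutFixedTorsionProofs` (automorphisms with `u = ±1`). Written by the cell `abc-iut` (seat
abc-iut-w5-d047) as the REAL form — for Weierstrass equations over fields — of

> S. Mochizuki, *Inter-universal Teichmüller theory IV* (kurims Apr-2020 manuscript), Prop. 1.8
> (ii) (pp. 18–19): "… we have a natural exact sequence `1 → Aut_k̄(E_k̄) → Aut_k(E_k̄) → G_k` — where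
> the image `G_E ⊆ G_k` of the homomorphism `Aut_k(E_k̄) → G_k` is open — … The finite extension
> `k_E` of `k` determined by `G_E` is the minimal field of definition of `E_k̄`, i.e., the field
> generated over `k` by the `j`-invariant of `E_k̄`. Finally, the homomorphism `Aut_k(E_k̄) → G_k`
> admits a section over `G_E`; the datum of a model of `E_k̄` over `k_H` … is equivalent to the datum
> of a section … over `H`", and (iii) (p. 19): "suppose further that `Aut_k̄(E_k̄) = {±1}`. Then
> the representation `ρ₂ : Aut_k(E_k̄) → Aut(E_k̄[2])` factors through `G_E`", with its proof
> (p. 20): "`Aut_k̄(E_k̄) = {±1}` acts trivially on `E_k̄[2]`".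

The tree types Prop. 1.8 only over an abstract interface (`Literature.IUT.LogVolume.Prop18`,
`P18_ii`, `P18_iii`; interface reductions in `TorsionPointsFactsProofs2`); here the content is PROVED
in coordinates. An elliptic curve over `K` is an elliptic Weierstrass equation `W`; for a ring
automorphism `σ` of `K` its conjugate is `W^σ = W.map σ`, and a `k`-automorphism of the `k`-scheme
`E_K` lying over `σ` is a change of variables `A` over `K` with `A • W^σ = W` (it acts on points by
`P ↦ A(σ̃ P)`); `Aut_K(W) = {D | D • W = W}`.

## Statements proved

* (ii) `G_E = Stab(j)`: `exists_variableChange_smul_map_iff_j` — for `W` elliptic over a separably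
  closed `K` and `σ : K →+* K`, `(∃ A, A • W^σ = W) ↔ σ j(W) = j(W)` (Mathlib
  `exists_variableChange_of_j_eq`); for `σ ∈ Aut(K/k)`: `↔ σ ∈ Gal(K/k(j))`
  (`fixingSubgroup_adjoin_j_eq_stabilizer`, `exists_variableChange_smul_map_iff_mem_fixingSubgroup`).
* (ii) "`G_E` open, `k_E = k(j)` finite over `k`": `isOpen_stabilizer_j` (Krull topology, `j`
  algebraic over `k`), `finiteDimensional_adjoin_j`, `fixedField_stabilizer_j` (`K/k` Galois:
  `Fix(G_E) = k(j)`, Mathlib's infinite Galois correspondence).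
* (ii) "section over `G_E`" = descent to `k(j)`: `exists_model_over_adjoin_j` (`W ≅ W₀ ⊗_{k(j)} K`
  for some `W₀` over `k(j)`, via Mathlib `WeierstrassCurve.ofJ`) and the section in cocycle
  coordinates `exists_section_over_stabilizer_j`: `σ ↦ A_σ := C⁻¹σ(C)` with `A_σ • W^σ = W` on
  `G_E` and `A_{στ} = A_σ σ(A_τ)`.
* (iii): `VariableChange.congrEquiv_pointEquiv_eq_self_of_two_torsion` — an automorphism with
  `u = ±1` fixes `W[2]` pointwise; `VariableChange.u_eq_one_or_neg_one_of_j_ne` — for `j ≠ 0, 1728`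
  in characteristic `∤ 6` every automorphism has `u = ±1` (Silverman *AEC* III.10.1, generic case);
  `semilinear_two_torsion_eq` — two `k`-automorphisms of `E_K` over the SAME `σ` induce the same
  map `W^σ[2] → W[2]`, i.e. "`ρ₂` factors through `G_E`" (`…_of_j_ne` packages the `j ≠ 0, 1728` case).

## References

* [Mochizuki2012] S. Mochizuki, IUT IV, Prop. 1.8 (ii), (iii) pp. 18–20.
* [SilvermanAEC2009] J. H. Silverman, *The Arithmetic of Elliptic Curves*, 2nd ed.: III.1
  (Table 3.1, `j` determines the `K̄`-isomorphism class, Prop. 1.4 (b)(c)), III.10.1.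

## Design

Pure theorems, `open scoped Classical` as in the companion files; deliberate dot-notation extensions
of Mathlib's `WeierstrassCurve` namespace. No definitions. Axioms: `propext`, `Classical.choice`,
`Quot.sound`.
-/

noncomputable section

open scoped Classical

universe u v

namespace WeierstrassCurve

open Literature.NumberTheory.EllipticCurves

/-! ## §1. (ii): `G_E` is the stabiliser of the `j`-invariant -/

section Stabilizer

variable {K : Type u} [Field K] (W : WeierstrassCurve K)

/-- `j` of equal elliptic Weierstrass equations agree (the `IsElliptic` witnesses may differ).
[folklore] -/
private theorem j_congr {W₁ W₂ : WeierstrassCurve K} [W₁.IsElliptic] [W₂.IsElliptic] (h : W₁ = W₂) :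
    W₁.j = W₂.j := by
  subst h
  rfl

/-- If a change of variables carries the conjugate `W^σ` to `W`, then `σ` fixes `j(W)`
(`j(A • W^σ) = j(W^σ) = σ j(W)`). [cite: SilvermanAEC2009, III.1 Prop. 1.4 (b)] -/
theorem apply_j_eq_of_variableChange_smul_map [W.IsElliptic] (σ : K →+* K) {A : VariableChange K}
    (h : A • W.map σ = W) : σ W.j = W.j := by
  rw [← map_j, ← variableChange_j (W.map σ) A]
  exact j_congr h

/-- **`G_E = Stab(j)` ([IUTchIV] Prop. 1.8 (ii): "`k_E` … is … the field generated over `k` by the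
`j`-invariant").** For `W` elliptic over a separably closed field `K` and a ring endomorphism `σ` of
`K`: some change of variables over `K` carries `W^σ` to `W` (i.e. `σ` lifts to a `k`-automorphism of
the scheme `E_K`) iff `σ` fixes `j(W)` (Mathlib `exists_variableChange_of_j_eq`: over a separably
closed field the `j`-invariant classifies). [cite: SilvermanAEC2009, III.1 Prop. 1.4 (b)(c)] -/
theorem exists_variableChange_smul_map_iff_j [IsSepClosed K] [W.IsElliptic] (σ : K →+* K) :
    (∃ A : VariableChange K, A • W.map σ = W) ↔ σ W.j = W.j := by
  refine ⟨fun ⟨A, h⟩ => W.apply_j_eq_of_variableChange_smul_map σ h, fun h => ?_⟩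
  exact exists_variableChange_of_j_eq (W.map σ) W (by rw [map_j, h])

end Stabilizer

/-! ## §2. (ii): `G_E` is open; `k_E = k(j)` is finite over `k` -/

section Galois

variable (k : Type u) {K : Type v} [Field k] [Field K] [Algebra k K] (W : WeierstrassCurve K)

/-- `Gal(K/k(j)) = Stab(j)` inside `Aut(K/k)` (the subgroup of `G_k` determined by "the field generated over
`k` by the `j`-invariant", [IUTchIV] Prop. 1.8 (ii)). [cite: Mochizuki2012, IUTchIV Prop 1.8 (ii) p.19] -/
theorem fixingSubgroup_adjoin_j_eq_stabilizer [W.IsElliptic] :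
    (IntermediateField.adjoin k ({W.j} : Set K)).fixingSubgroup =
      MulAction.stabilizer (K ≃ₐ[k] K) W.j := by
  ext σ
  rw [IntermediateField.mem_fixingSubgroup_iff, MulAction.mem_stabilizer_iff, AlgEquiv.smul_def]
  constructor
  · intro h
    exact h W.j (IntermediateField.mem_adjoin_simple_self k W.j)
  · intro h x hx
    have hle : IntermediateField.adjoin k ({W.j} : Set K) ≤
        IntermediateField.fixedField (MulAction.stabilizer (K ≃ₐ[k] K) W.j) := by
      rw [IntermediateField.adjoin_simple_le_iff, IntermediateField.mem_fixedField_iff]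
      intro τ hτ
      rwa [MulAction.mem_stabilizer_iff, AlgEquiv.smul_def] at hτ
    have hx' := hle hx
    rw [IntermediateField.mem_fixedField_iff] at hx'
    exact hx' σ (by rwa [MulAction.mem_stabilizer_iff, AlgEquiv.smul_def])

/-- **`G_E = Gal(K/k(j))`** for `σ ∈ Aut(K/k)`, `W` elliptic over `K` separably closed.
[cite: SilvermanAEC2009, III.1 Prop. 1.4 (b)(c)] -/
theorem exists_variableChange_smul_map_iff_mem_fixingSubgroup [IsSepClosed K] [W.IsElliptic]
    (σ : K ≃ₐ[k] K) :
    (∃ A : VariableChange K, A • W.map (σ : K →+* K) = W) ↔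
      σ ∈ (IntermediateField.adjoin k ({W.j} : Set K)).fixingSubgroup := by
  rw [W.exists_variableChange_smul_map_iff_j, fixingSubgroup_adjoin_j_eq_stabilizer,
    MulAction.mem_stabilizer_iff, AlgEquiv.smul_def]
  rfl

/-- **`k_E = k(j)` is a finite extension of `k`** (`j` algebraic over `k`).
[cite: Mochizuki2012, IUTchIV Prop 1.8 (ii) p.19] -/
theorem finiteDimensional_adjoin_j [W.IsElliptic] (hj : _root_.IsIntegral k W.j) :
    FiniteDimensional k (IntermediateField.adjoin k ({W.j} : Set K)) :=
  IntermediateField.adjoin.finiteDimensional hj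

/-- **`G_E ⊆ G_k` is open** (Krull topology), for `j(W)` algebraic over `k`.
[cite: Mochizuki2012, IUTchIV Prop 1.8 (ii) p.18] -/
theorem isOpen_stabilizer_j [W.IsElliptic] (hj : _root_.IsIntegral k W.j) :
    IsOpen (MulAction.stabilizer (K ≃ₐ[k] K) W.j : Set (K ≃ₐ[k] K)) := by
  rw [← fixingSubgroup_adjoin_j_eq_stabilizer]
  haveI := W.finiteDimensional_adjoin_j k hj
  exact IntermediateField.fixingSubgroup_isOpen _

/-- **The field determined by `G_E` is `k(j)`** (`K/k` Galois, e.g. `K = k̄`, `k` perfect):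
`Fix(Stab(j)) = k(j)` (Mathlib's Galois correspondence for infinite extensions).
[cite: Mochizuki2012, IUTchIV Prop 1.8 (ii) p.19] -/
theorem fixedField_stabilizer_j [IsGalois k K] [W.IsElliptic] :
    IntermediateField.fixedField (MulAction.stabilizer (K ≃ₐ[k] K) W.j) =
      IntermediateField.adjoin k ({W.j} : Set K) := by
  rw [← fixingSubgroup_adjoin_j_eq_stabilizer]
  exact InfiniteGalois.fixedField_fixingSubgroup _

/-! ## §3. (ii): `E_K` descends to `k(j)`; the section over `G_E` in cocycle coordinates -/

/-- **`E_K` has a model over `k(j)`**: for `W` elliptic over `K` separably closed there are a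
Weierstrass equation `W₀` over the subfield `k(j) ⊆ K` and a change of variables `C` over `K` with
`C • W = W₀ ⊗ K` (the curve `ofJ j` has `j`-invariant `j`, and `j` classifies over `K`).
[cite: SilvermanAEC2009, III.1 Prop. 1.4 (b)(c)] -/
theorem exists_model_over_adjoin_j [IsSepClosed K] [W.IsElliptic] :
    ∃ (W₀ : WeierstrassCurve (IntermediateField.adjoin k ({W.j} : Set K))) (C : VariableChange K),
      C • W = W₀.map (algebraMap (IntermediateField.adjoin k ({W.j} : Set K)) K) := by
  let j₀ : IntermediateField.adjoin k ({W.j} : Set K) :=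
    ⟨W.j, IntermediateField.mem_adjoin_simple_self k W.j⟩
  refine ⟨WeierstrassCurve.ofJ j₀, ?_⟩
  have hj : W.j = ((ofJ j₀).map (algebraMap (IntermediateField.adjoin k ({W.j} : Set K)) K)).j := by
    rw [map_j, ofJ_j]
    rfl
  exact exists_variableChange_of_j_eq W _ hj

/-- The coercion of a product of `k`-algebra automorphisms to ring homomorphisms. [folklore] -/
private theorem algEquiv_mul_coe_ringHom (σ τ : K ≃ₐ[k] K) :
    ((σ * τ : K ≃ₐ[k] K) : K →+* K) = (σ : K →+* K).comp (τ : K →+* K) :=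
  RingHom.ext fun _ => rfl

/-- **The section of `Aut_k(E_K) → G_k` over `G_E`, in cocycle coordinates** ([IUTchIV] Prop. 1.8
(ii), last part): for `W` elliptic over `K` separably closed there is `σ ↦ A_σ` (namely
`A_σ = C⁻¹σ(C)` for `C • W = W₀ ⊗ K` a descent to `k(j)`) with `A_σ • W^σ = W` for every `σ` fixing
`j` (so `(σ, A_σ)` IS a `k`-automorphism of `E_K` over `σ`) and the homomorphism law
`A_{στ} = A_σ · σ(A_τ)` of composition of semi-linear automorphisms.
[cite: Mochizuki2012, IUTchIV Prop 1.8 (ii) p.19] -/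
theorem exists_section_over_stabilizer_j [IsSepClosed K] [W.IsElliptic] :
    ∃ A : (K ≃ₐ[k] K) → VariableChange K,
      (∀ σ : K ≃ₐ[k] K, σ W.j = W.j → A σ • W.map (σ : K →+* K) = W) ∧
      (∀ σ τ : K ≃ₐ[k] K, A (σ * τ) = A σ * (A τ).map (σ : K →+* K)) := by
  obtain ⟨W₀, C, hC⟩ := W.exists_model_over_adjoin_j k
  refine ⟨fun σ => C⁻¹ * C.map (σ : K →+* K), fun σ hσ => ?_, fun σ τ => ?_⟩
  · -- `σ` fixes `k(j)`, hence the descended equation `W₀ ⊗ K`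
    have hmem : σ ∈ (IntermediateField.adjoin k ({W.j} : Set K)).fixingSubgroup := by
      rw [fixingSubgroup_adjoin_j_eq_stabilizer, MulAction.mem_stabilizer_iff, AlgEquiv.smul_def]
      exact hσ
    rw [IntermediateField.mem_fixingSubgroup_iff] at hmem
    have hfix : (σ : K →+* K).comp (algebraMap (IntermediateField.adjoin k ({W.j} : Set K)) K) =
        algebraMap (IntermediateField.adjoin k ({W.j} : Set K)) K :=
      RingHom.ext fun x => hmem x x.2
    have h1 : (W₀.map (algebraMap _ K)).map (σ : K →+* K) = W₀.map (algebraMap _ K) := by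
      rw [map_map, hfix]
    have h2 : C.map (σ : K →+* K) • W.map (σ : K →+* K) = C • W := by
      rw [map_variableChange, hC, h1]
    rw [mul_smul, h2, inv_smul_smul]
  · -- the cocycle identity `C⁻¹ (στ)(C) = C⁻¹ σ(C) · σ(C⁻¹ τ(C))`
    change C⁻¹ * VariableChange.mapHom _ C =
      C⁻¹ * VariableChange.mapHom _ C * VariableChange.mapHom _ (C⁻¹ * VariableChange.mapHom _ C)
    rw [map_mul, map_inv, algEquiv_mul_coe_ringHom]
    have hmm : VariableChange.mapHom ((σ : K →+* K).comp (τ : K →+* K)) C =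
        VariableChange.mapHom (σ : K →+* K) (VariableChange.mapHom (τ : K →+* K) C) :=
      (VariableChange.map_map C (τ : K →+* K) (σ : K →+* K)).symm
    rw [hmm]
    group

end Galois

/-! ## §4. (iii): `Aut_K(E) = {±1}` acts trivially on `E[2]` -/

section TwoTorsion

variable {K : Type u} [Field K] (W : WeierstrassCurve K)

/-- A `2`-torsion point is its own negative. [folklore] -/
private theorem Affine.Point.neg_eq_self_of_two_nsmul_eq_zero {P : W.toAffine.Point} (h : 2 • P = 0) :
    -P = P :=
  neg_eq_of_add_eq_zero_left (by rwa [two_nsmul] at h)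

/-- **`{±1}` acts trivially on `E[2]`** (the printed proof of [IUTchIV] Prop. 1.8 (iii), p. 20): in
characteristic `∤ 6`, an automorphism `D • W = W` with `u(D) = ±1` (i.e. `D ∈ {1, [-1]}`) fixes
every `2`-torsion point. [cite: SilvermanAEC2009, III.10 Thm. 10.1 and III.2 (negation)] -/
theorem VariableChange.congrEquiv_pointEquiv_eq_self_of_two_torsion (h2 : (2 : K) ≠ 0)
    (h3 : (3 : K) ≠ 0) {D : VariableChange K} (hD : D • W = W) (hu : D.u = 1 ∨ D.u = -1)
    {T : W.toAffine.Point} (hT : 2 • T = 0) :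
    Affine.Point.congrEquiv hD (VariableChange.pointEquiv W D T) = T := by
  rcases hu with hu | hu
  · have hD1 : D = 1 := VariableChange.eq_one_of_smul_eq_of_u_eq_one W h2 h3 hD hu
    subst hD1
    rcases T with _ | ⟨x, y, h⟩
    · change Affine.Point.congrEquiv hD (VariableChange.pointEquiv W 1 0) = 0
      simp only [map_zero]
    · rw [VariableChange.pointEquiv_some, Affine.Point.congrEquiv_some]
      simp only [toX_one, toY_one]
  · rw [VariableChange.map_eq_neg_of_smul_eq_of_u_eq_neg_one W h2 h3 hD hu T]
    exact Affine.Point.neg_eq_self_of_two_nsmul_eq_zero W hT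

/-- `j ≠ 0` forces `c₄ ≠ 0`. [folklore] -/
private theorem c₄_ne_zero_of_j_ne_zero [W.IsElliptic] (h0 : W.j ≠ 0) : W.c₄ ≠ 0 :=
  fun h => h0 (W.j_eq_zero h)

/-- `j ≠ 1728` forces `c₆ ≠ 0` (`j − 1728 = c₆²/Δ`). [cite: SilvermanAEC2009, III.1 (c-relations)] -/
theorem c₆_ne_zero_of_j_ne [W.IsElliptic] (h1728 : W.j ≠ 1728) : W.c₆ ≠ 0 := by
  intro h
  apply h1728
  have hrel := W.c_relation
  rw [h, zero_pow two_ne_zero, sub_zero] at hrel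
  rw [j, ← hrel, ← W.coe_Δ', mul_left_comm, Units.inv_mul, mul_one]

/-- **`Aut_K(W) = {±1}` for `j ≠ 0, 1728`** (generic case of Silverman *AEC* III.10.1), in the form
used here: an automorphism `D • W = W` has `u(D)⁴ = 1` (from `c₄ = u⁻⁴c₄`, `c₄ ≠ 0`) and `u(D)⁶ = 1`
(from `c₆ = u⁻⁶c₆`, `c₆ ≠ 0`), hence `u(D)² = 1`, i.e. `u(D) = ±1` — and then `D ∈ {1, [-1]}` in
characteristic `∤ 6` by the tree's `eq_one_of_smul_eq_of_u_eq_one` /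
`r_s_t_of_smul_eq_of_u_eq_neg_one`. [cite: SilvermanAEC2009, III.10 Thm. 10.1] -/
theorem VariableChange.u_eq_one_or_neg_one_of_j_ne [W.IsElliptic] (h0 : W.j ≠ 0) (h1728 : W.j ≠ 1728)
    {D : VariableChange K} (hD : D • W = W) : D.u = 1 ∨ D.u = -1 := by
  have hc4 : W.c₄ ≠ 0 := W.c₄_ne_zero_of_j_ne_zero h0
  have hc6 : W.c₆ ≠ 0 := W.c₆_ne_zero_of_j_ne h1728
  have h4 : ((D.u⁻¹ : Kˣ) : K) ^ 4 = 1 := by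
    have := congrArg WeierstrassCurve.c₄ hD
    rw [variableChange_c₄] at this
    exact mul_right_cancel₀ hc4 (by rw [this, one_mul])
  have h6 : ((D.u⁻¹ : Kˣ) : K) ^ 6 = 1 := by
    have := congrArg WeierstrassCurve.c₆ hD
    rw [variableChange_c₆] at this
    exact mul_right_cancel₀ hc6 (by rw [this, one_mul])
  have h2' : ((D.u⁻¹ : Kˣ) : K) ^ 2 = 1 := by
    have e : ((D.u⁻¹ : Kˣ) : K) ^ 6 = ((D.u⁻¹ : Kˣ) : K) ^ 4 * ((D.u⁻¹ : Kˣ) : K) ^ 2 := by ring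
    rw [h4, one_mul] at e
    rw [← e, h6]
  have hsq : (D.u : K) ^ 2 = 1 := by
    have := congrArg (fun x : K => x * (D.u : K) ^ 2) h2'
    simp only [one_mul] at this
    rw [← this, ← mul_pow, Units.inv_mul, one_pow]
  rcases sq_eq_one_iff.mp hsq with h | h
  · exact Or.inl (Units.ext h)
  · exact Or.inr (Units.ext (by rw [h, Units.val_neg, Units.val_one]))

/-! ### (iii): two semi-linear automorphisms over the same `σ` agree on the `2`-torsion -/

/-- Composition in coordinates: if `A • X = W`, `D • W = W` and `B = D·A`, then on points
`B = D ∘ A` (through the transport-along-equality casts `congrEquiv`). [folklore] -/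
private theorem VariableChange.congrEquiv_pointEquiv_eq_comp {X : WeierstrassCurve K} {A B D : VariableChange K}
    (hA : A • X = W) (hB : B • X = W) (hD : D • W = W) (hBD : B = D * A) (T : X.toAffine.Point) :
    Affine.Point.congrEquiv hB (VariableChange.pointEquiv X B T) =
      Affine.Point.congrEquiv hD (VariableChange.pointEquiv W D
        (Affine.Point.congrEquiv hA (VariableChange.pointEquiv X A T))) := by
  rcases T with _ | ⟨x, y, h⟩
  · change Affine.Point.congrEquiv hB (VariableChange.pointEquiv X B 0) =
      Affine.Point.congrEquiv hD (VariableChange.pointEquiv W D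
        (Affine.Point.congrEquiv hA (VariableChange.pointEquiv X A 0)))
    simp only [map_zero]
  · rw [VariableChange.pointEquiv_some, Affine.Point.congrEquiv_some, VariableChange.pointEquiv_some,
      Affine.Point.congrEquiv_some, VariableChange.pointEquiv_some, Affine.Point.congrEquiv_some]
    simp only [hBD, toX_mul, toY_mul]

/-- **[IUTchIV] Prop. 1.8 (iii) in real form: `ρ₂` factors through `G_E`.** Let `W` be a Weierstrass
equation over a field `K` of characteristic `∤ 6` all of whose automorphisms have `u = ±1`
("`Aut_K(E) = {±1}`"), `σ` a ring endomorphism of `K`, and `(σ, A)`, `(σ, B)` two `k`-automorphisms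
of `E_K` over the SAME `σ` (`A • W^σ = W`, `B • W^σ = W`). Then they induce the same map
`W^σ[2] → W[2]`: the action of `Aut_k(E_K)` on `E[2]` depends only on the image in `G_k` (printed
proof p. 20: `B ∘ A⁻¹ ∈ Aut_K(E) = {±1}` acts trivially on `E[2]`).
[cite: SilvermanAEC2009, III.10 Thm. 10.1] -/
theorem semilinear_two_torsion_eq (h2 : (2 : K) ≠ 0) (h3 : (3 : K) ≠ 0)
    (hAut : ∀ D : VariableChange K, D • W = W → D.u = 1 ∨ D.u = -1) (σ : K →+* K)
    {A B : VariableChange K} (hA : A • W.map σ = W) (hB : B • W.map σ = W)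
    {T : (W.map σ).toAffine.Point} (hT : 2 • T = 0) :
    Affine.Point.congrEquiv hA (VariableChange.pointEquiv (W.map σ) A T) =
      Affine.Point.congrEquiv hB (VariableChange.pointEquiv (W.map σ) B T) := by
  -- `D := B A⁻¹` is an automorphism of `W`
  have hD : (B * A⁻¹) • W = W := by
    conv_lhs => rw [← hA]
    rw [mul_smul, inv_smul_smul, hB]
  have hBD : B = B * A⁻¹ * A := by rw [inv_mul_cancel_right]
  rw [VariableChange.congrEquiv_pointEquiv_eq_comp W hA hB hD hBD T]
  -- the `2`-torsion point `A(σ̃ T)` of `W` is fixed by `D ∈ {±1}`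
  refine (VariableChange.congrEquiv_pointEquiv_eq_self_of_two_torsion W h2 h3 hD (hAut _ hD) ?_).symm
  rw [← map_nsmul, ← map_nsmul, hT, map_zero, map_zero]

/-- **[IUTchIV] Prop. 1.8 (iii) in real form, generic `j`**: for `W` elliptic over a field of
characteristic `∤ 6` with `j(W) ≠ 0, 1728` (so that `Aut_K(W) = {±1}`), two `k`-automorphisms of
`E_K` over the same `σ` induce the same map on the `2`-torsion. [cite: SilvermanAEC2009, III.10 Thm. 10.1] -/
theorem semilinear_two_torsion_eq_of_j_ne [W.IsElliptic] (h2 : (2 : K) ≠ 0) (h3 : (3 : K) ≠ 0)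
    (h0 : W.j ≠ 0) (h1728 : W.j ≠ 1728) (σ : K →+* K) {A B : VariableChange K}
    (hA : A • W.map σ = W) (hB : B • W.map σ = W) {T : (W.map σ).toAffine.Point} (hT : 2 • T = 0) :
    Affine.Point.congrEquiv hA (VariableChange.pointEquiv (W.map σ) A T) =
      Affine.Point.congrEquiv hB (VariableChange.pointEquiv (W.map σ) B T) :=
  W.semilinear_two_torsion_eq h2 h3
    (fun _ hD => VariableChange.u_eq_one_or_neg_one_of_j_ne W h0 h1728 hD) σ hA hB hT

end TwoTorsion

end WeierstrassCurve
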